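import Summits.HodgeConjecture.HodgeConjecture.Theorems.PadicSemiregularLiftHodgeFermatVarietiesSaturation33Graph
import Summits.HodgeConjecture.HodgeConjecture.Theorems.PadicSemiregularLiftHodgeFermatVarietiesLatticeCriterion
import Summits.HodgeConjecture.HodgeConjecture.Theorems.PadicSemiregularLiftHodgeFermatVarietiesPrintedSupply
import Summits.HodgeConjecture.HodgeConjecture.Theorems.PadicSemiregularLiftHodgeFermatVarietiesLevelRaise
import HarnessLib

/-!
# D33, part 2: every Hodge multiset of `ℤ/33` is stably reachable — the degree-33 saturation certificate

Crux `HodgeFermatVarieties` (stmt-HodgeConjecture-1334, route `PadicSemiregularLift`), line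
`cancel-by-any-claim-lattice`. The line's Transfer `hodgeConjectureFor_of_saturated` (skeleton,
sorry-free) turns "every non-empty Hodge multiset of level `m` is STABLY REACHABLE from the printed
supply" (`C⁺(m)`) into HC for every smooth projective Fermat variety `Xⁿₘ`, modulo the named facts of
S0 and the research-risk-nil stubs S2↑, S2↓, S3a, S5 (S1, S3b are landed). This file PROVES `C⁺(33)`:

    stableReach_thirtyThree : ∀ s : Multiset (ZMod 33), IsHodgeMultiset s → StableReach[33, s]

(`k = 2`: reachability at level `66`). `m = 33` is the first degree open in print (da Silva 2021,
`X⁴₃₃`); at level `33` alone the printed calculus provably does NOT reach da Silva's class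
(Disproof §7, `exists_levelCalculusClosed_not_daSilva33`), so the level change is essential.

Proof. Part 1 (`…Saturation33Graph`) gives the multiset identity
`s + Σ_{a∈F} c_a • B a = Σ_{a∈F} c_a • A a`. CERTIFICATES: for each `a ∈ F`,
`2•(A a) + Σ(N66 a) = 2•(B a) [+ 2•G if a is odd] + Σ(P66 a)` as multisets of `ℤ/66`, with `P66 a`,
`N66 a` explicit families of supply elements of level `66` (pairs, Hodge 4-multisets, the standard
element `σ_{11,2}`) — 32 distinct generators, sizes ≤ 9 (`cert66_of_mem_F`, `decide`); the four ODD
vectors (`a = 2, 13, 20, 31`: odd number of multiples of `11`, the disprover's `C33` parity) are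
certified relative to da Silva's class `G = {7,10,13,19,22,28}`, whose own level-66 certificate
`2•G + ΣNEG = ΣPOS` (115 generators; the idea card's certificate, re-verified by three triagers and
the disprover) is `identity_sixtySix`. ASSEMBLY: raise the graph identity to level `66`, add the
weighted certificates and `n • (2•G + ΣNEG = ΣPOS)` (`n = Σ_{a odd} c_a`), and cancel
`Σ c_a • 2•(B a)` (multisets are cancellative): `2•s + ΣN = ΣP` with
`N = Σ_a c_a • N66 a + n • NEG`, `P = Σ_a c_a • P66 a + n • POS`.

References: [daSilva2021HodgeFermat] G. da Silva Jr., arXiv:2101.04739, Prop. 3.6 / §3 (the class of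
`X⁴₃₃`); [Aoki1987] N. Aoki, J. Math. Soc. Japan 39 (1987) Thm 1-4, Thm 2-1 and §1 p. 387 (the
supply: pairs, Fermat-surface characters, standard elements `σ_{p,a}`).
-/

set_option linter.dupNamespace false

noncomputable section

open Finset
open Literature.AlgebraicGeometry.HodgeTheory Literature.AlgebraicGeometry.HodgeTheory.FermatCharacter

namespace Summit.HodgeConjecture.HodgeConjecture.Theorems.CancelByAnyClaimLattice.D33

/-- `Supply[M]` — the printed supply of level `M` (local notation of the line, verbatim). -/
local notation3 (prettyPrint := false) "Supply[" M "]" =>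
  ({s : Multiset (ZMod M) | ∃ a : ZMod M, a ≠ 0 ∧ s = ({a, -a} : Multiset (ZMod M))} ∪
    {s : Multiset (ZMod M) | IsHodgeMultiset s ∧ Multiset.card s = 4} ∪
    {s : Multiset (ZMod M) | IsHodgeMultiset s ∧ IsSemiDecomposable s} ∪
    {s : Multiset (ZMod M) | ∃ (p : ℕ) (a : ZMod M), p.Prime ∧ p ≠ 2 ∧ p ∣ M ∧
        2 < (M / p) / Nat.gcd (ZMod.val a) (M / p) ∧
        s = Multiset.map (fun j : ℕ => a + (j : ZMod M) * ((M / p : ℕ) : ZMod M)) (Multiset.range p) +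
              {-((p : ZMod M) * a)}} : Set (Multiset (ZMod M)))

/-- `Reach[M, s]` — ℤ-reachability from the supply (local notation of the line, verbatim). -/
local notation3 (prettyPrint := false) "Reach[" M ", " s "]" =>
  ∃ P N : Multiset (Multiset (ZMod M)),
    (∀ u ∈ P, u ∈ Supply[M]) ∧ (∀ u ∈ N, u ∈ Supply[M]) ∧ s + Multiset.sum N = Multiset.sum P

/-- `LevelRaise[k, m, s]` — level raising `s ↦ k • s` (local notation of the line, verbatim). -/
local notation3 (prettyPrint := false) "LevelRaise[" k ", " m ", " s "]" =>
  Multiset.map (fun a : ZMod m => ((k * ZMod.val a : ℕ) : ZMod (k * m))) s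

/-- `StableReach[m, s]` (local notation of the line, verbatim). -/
local notation3 (prettyPrint := false) "StableReach[" m ", " s "]" =>
  ∃ k : ℕ, 0 < k ∧ Reach[k * m, LevelRaise[k, m, s]]

/-! ### §4 The level-66 certificates -/

/-- The 20 units of `ℤ/66`, listed (Hodge-ness at level `66` is checked over this LIST — cheap for the kernel —
rather than over the `Fintype` of units). [folklore] -/
def unitReps66 : List (ZMod 66) := [1, 5, 7, 13, 17, 19, 23, 25, 29, 31, 35, 37, 41, 43, 47, 49, 53, 59, 61, 65]

/-- Every unit of `ℤ/66` is listed. [folklore] -/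
theorem mem_unitReps66 : ∀ x : ZMod 66, Nat.Coprime x.val 66 → x ∈ unitReps66 := by unfold unitReps66; decide

/-- **Hodge-ness at level `66` from the listed units.** [cite: Shioda1979PJA, §1 eq. (2)] -/
theorem isHodgeMultiset_of_reps66 {u : Multiset (ZMod 66)}
    (h : ((∀ a ∈ u, a ≠ 0) ∧ u.sum = 0) ∧ ∀ t ∈ unitReps66, 2 * mNormSum (u.map fun a ↦ t * a) = 66 * Multiset.card u) :
    IsHodgeMultiset u :=
  ⟨h.1, fun t ↦ h.2 _ (mem_unitReps66 _ (ZMod.val_coe_unit_coprime t))⟩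

/-- The 33 Hodge 4-multisets of `ℤ/66` (Fermat-surface classes of `X²₆₆`, among them the `3`-standard ones)
used by the certificates of this file. [folklore] -/
def H4List66 : List (Multiset (ZMod 66)) :=
  [{1, 17, 50, 64}, {1, 23, 45, 63}, {1, 25, 44, 62}, {1, 33, 34, 64}, {1, 34, 35, 62}, {1, 37, 44, 50},
   {2, 24, 46, 60}, {2, 26, 40, 64}, {2, 35, 37, 58}, {3, 25, 47, 57}, {4, 12, 54, 62}, {4, 22, 44, 62},
   {4, 26, 48, 54}, {5, 27, 49, 51}, {6, 12, 54, 60}, {6, 16, 50, 60}, {6, 20, 42, 64}, {6, 28, 38, 60},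
   {6, 28, 48, 50}, {7, 29, 45, 51}, {8, 12, 54, 58}, {8, 30, 42, 52}, {9, 31, 39, 53}, {10, 14, 52, 56},
   {10, 32, 36, 54}, {11, 33, 44, 44}, {12, 20, 46, 54}, {12, 30, 34, 56}, {12, 32, 34, 54}, {20, 24, 42, 46},
   {24, 30, 36, 42}, {28, 30, 36, 38}, {30, 32, 34, 36}]

set_option maxRecDepth 100000 in set_option maxHeartbeats 1000000 in
/-- Every listed 4-multiset satisfies the listed-units Hodge conditions and has four elements. [folklore] -/
theorem h4List66_cond : ∀ u ∈ H4List66,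
    (((∀ a ∈ u, a ≠ 0) ∧ u.sum = 0) ∧ ∀ t ∈ unitReps66, 2 * mNormSum (u.map fun a ↦ t * a) = 66 * Multiset.card u) ∧
      Multiset.card u = 4 := by
  unfold H4List66 unitReps66 mNormSum; decide +kernel

/-- `CertShape[u]` — a cheap decidable sufficient condition for `u ∈ Supply[66]`: a pair, a LISTED Hodge
4-multiset, or one of the two `11`-standard 12-tuples. Local notation only. -/
local notation3 (prettyPrint := false) "CertShape[" u "]" =>
  ((∃ a : ZMod 66, a ≠ 0 ∧ u = ({a, -a} : Multiset (ZMod 66))) ∨ u ∈ H4List66 ∨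
    u = ({2, 8, 14, 20, 26, 32, 38, 44, 44, 50, 56, 62} : Multiset (ZMod 66)) ∨
    u = ({1, 7, 13, 19, 25, 31, 37, 43, 49, 55, 55, 61} : Multiset (ZMod 66)))

/-- `σ_{11,2}` of level `66` is a standard supply element (`p = 11`, `d = 6`, `(2,6) = 2`, `6/2 = 3 > 2`).
[cite: Aoki1987, §1 p. 387 (σ_{p,i}, d/(i,d) > 2)] -/
theorem sigma_eleven_two_mem :
    ({2, 8, 14, 20, 26, 32, 38, 44, 44, 50, 56, 62} : Multiset (ZMod 66)) ∈ Supply[66] :=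
  Or.inr ⟨11, 2, by decide, by decide, by decide, by decide, by decide⟩

/-- `σ_{11,1}` of level `66` is a standard supply element (`(1, 6) = 1`, `d = 6 > 2`).
[cite: Aoki1987, Thm. 2-1 (p. 388)] -/
theorem sigma_eleven_one_mem :
    ({1, 7, 13, 19, 25, 31, 37, 43, 49, 55, 55, 61} : Multiset (ZMod 66)) ∈ Supply[66] :=
  Or.inr ⟨11, 1, by decide, by decide, by decide, by decide, by decide⟩

/-- Every certificate shape is a supply element of level `66`. [folklore] -/
theorem mem_supply_of_certShape {u : Multiset (ZMod 66)} (h : CertShape[u]) : u ∈ Supply[66] := by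
  rcases h with h | h | rfl | rfl
  · exact Or.inl (Or.inl (Or.inl h))
  · exact Or.inl (Or.inl (Or.inr ⟨isHodgeMultiset_of_reps66 (h4List66_cond u h).1, (h4List66_cond u h).2⟩))
  · exact sigma_eleven_two_mem
  · exact sigma_eleven_one_mem

set_option maxRecDepth 100000 in set_option maxHeartbeats 1000000 in
/-- **The 22 basis certificates** (level `66`): `2•(A a) + Σ(N66 a) = 2•(B a) [+ 2•G for odd a] + Σ(P66 a)`. [folklore] -/
theorem cert66_of_mem_F : ∀ a ∈ Fset,
    LevelRaise[2, 33, A a] + (N66 a).sum =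
      LevelRaise[2, 33, B a] + (if oddF a then LevelRaise[2, 33, G] else 0) + (P66 a).sum := by
  unfold Fset A B N66 P66 oddF G; decide +kernel

set_option maxRecDepth 100000 in set_option maxHeartbeats 1000000 in
/-- All generators used by the 22 basis certificates have a certificate shape (10 pairs, 21 Hodge
4-multisets of `ℤ/66`, `σ_{11,2}`). [folklore] -/
theorem certShape_of_mem_F : ∀ a ∈ Fset, ∀ u ∈ P66 a + N66 a, CertShape[u] := by
  unfold Fset P66 N66 H4List66; decide +kernel

/-- `POS` — positive part of the level-66 certificate of da Silva's class (the idea card's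
certificate; 75 supply elements: 59 pairs, 16 Hodge 4-multisets). [folklore] -/
def POS : Multiset (Multiset (ZMod 66)) :=
  Multiset.replicate 10 {2, 64} + Multiset.replicate 5 {8, 58} + Multiset.replicate 5 {32, 34} +
  Multiset.replicate 5 {33, 33} +
  Multiset.replicate 3 {6, 60} + Multiset.replicate 3 {10, 56} + Multiset.replicate 3 {14, 52} +
  Multiset.replicate 3 {20, 46} + Multiset.replicate 3 {24, 42} + Multiset.replicate 3 {28, 38} +
  Multiset.replicate 3 {30, 36} +
  Multiset.replicate 2 {11, 55} + Multiset.replicate 2 {17, 49} + Multiset.replicate 2 {31, 35} +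
  {{3, 63}, {5, 61}, {9, 57}, {13, 53}, {19, 47}, {23, 43}, {27, 39}} +
  Multiset.replicate 2 {1, 25, 44, 62} + Multiset.replicate 3 {1, 34, 35, 62} +
  Multiset.replicate 7 {1, 37, 44, 50} +
  {{7, 29, 45, 51}} + Multiset.replicate 3 {4, 26, 48, 54}

/-- `NEG` — negative part of the level-66 certificate of da Silva's class (40 supply elements: 17
Hodge 4-multisets, 4 pairs, 16 `3`-standard 4-multisets, `σ_{11,2}` twice, `σ_{11,1}` once). [folklore] -/
def NEG : Multiset (Multiset (ZMod 66)) :=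
  Multiset.replicate 8 {1, 33, 34, 64} + Multiset.replicate 5 {2, 35, 37, 58} +
  Multiset.replicate 2 {1, 17, 50, 64} + Multiset.replicate 2 {11, 33, 44, 44} +
  Multiset.replicate 3 {4, 62} + {{29, 37}} +
  Multiset.replicate 3 {6, 28, 48, 50} + Multiset.replicate 3 {10, 32, 36, 54} +
  Multiset.replicate 3 {8, 30, 42, 52} + Multiset.replicate 3 {2, 24, 46, 60} +
  {{9, 31, 39, 53}, {5, 27, 49, 51}, {3, 25, 47, 57}, {1, 23, 45, 63}} +
  Multiset.replicate 2 {2, 8, 14, 20, 26, 32, 38, 44, 44, 50, 56, 62} +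
  {{1, 7, 13, 19, 25, 31, 37, 43, 49, 55, 55, 61}}

set_option maxRecDepth 100000 in set_option maxHeartbeats 1000000 in
/-- **The level-66 identity for da Silva's class, kernel-checked**: `2•G + ΣNEG = ΣPOS` (182 elements
a side). [folklore] -/
theorem identity_sixtySix : LevelRaise[2, 33, G] + NEG.sum = POS.sum := by
  unfold G; decide +kernel

set_option maxRecDepth 100000 in set_option maxHeartbeats 1000000 in
/-- All 115 generators of the gap certificate (`POS` and `NEG`) have a certificate shape (pairs, listed Hodge
4-multisets, `σ_{11,2}`, `σ_{11,1}`). [folklore] -/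
theorem certShape_of_mem_POS_NEG : ∀ u ∈ POS + NEG, CertShape[u] := by
  unfold POS NEG H4List66; decide +kernel

/-! ### §5 Assembly -/

/-- **D33 — every Hodge multiset of `ℤ/33` is stably reachable** (`k = 2`: at level `66`), hence
da Silva's degree `33` has a SATURATED Hodge lattice and, by the line's Transfer
`hodgeConjectureFor_of_saturated`, HC holds for every `Xⁿ₃₃` modulo the named facts of S0 and the
stubs S2↑, S2↓, S3a, S5. [cite: daSilva2021HodgeFermat, §3 (X⁴₃₃, Prop. 3.6)] -/
theorem stableReach_thirtyThree : ∀ s : Multiset (ZMod 33), IsHodgeMultiset s → StableReach[33, s] := by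
  intro s hs
  refine ⟨2, Nat.two_pos, ?_⟩
  -- weights: `c a` = multiplicity of `a` in `s`; `n` = number of entries of `s` in the odd classes
  obtain ⟨c, hc⟩ : ∃ c : ZMod 33 → ℕ, c = fun a ↦ Multiset.count a s := ⟨_, rfl⟩
  obtain ⟨n, hn⟩ : ∃ n : ℕ, n = ∑ a ∈ Fset, if oddF a then c a else 0 := ⟨_, rfl⟩
  have hgraph : s + ∑ a ∈ Fset, c a • B a = ∑ a ∈ Fset, c a • A a := by rw [hc]; exact graph_identity33 hs
  refine ⟨(∑ a ∈ Fset, c a • P66 a) + n • POS, (∑ a ∈ Fset, c a • N66 a) + n • NEG, ?_, ?_, ?_⟩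
  · intro u hu
    rcases Multiset.mem_add.1 hu with hu | hu
    · obtain ⟨a, ha, hu⟩ := Multiset.mem_sum.1 hu
      have hu' : u ∈ P66 a := Multiset.mem_of_mem_nsmul hu
      exact mem_supply_of_certShape (certShape_of_mem_F a ha u (Multiset.mem_add.2 (Or.inl hu')))
    · exact mem_supply_of_certShape (certShape_of_mem_POS_NEG u (Multiset.mem_add.2 (Or.inl (Multiset.mem_of_mem_nsmul hu))))
  · intro u hu
    rcases Multiset.mem_add.1 hu with hu | hu
    · obtain ⟨a, ha, hu⟩ := Multiset.mem_sum.1 hu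
      have hu' : u ∈ N66 a := Multiset.mem_of_mem_nsmul hu
      exact mem_supply_of_certShape (certShape_of_mem_F a ha u (Multiset.mem_add.2 (Or.inr hu')))
    · exact mem_supply_of_certShape (certShape_of_mem_POS_NEG u (Multiset.mem_add.2 (Or.inr (Multiset.mem_of_mem_nsmul hu))))
  · -- the identity
    have hI := congrArg (Multiset.map (fun a : ZMod 33 => ((2 * ZMod.val a : ℕ) : ZMod (2 * 33)))) hgraph
    rw [Multiset.map_add, map_sum_nsmul, map_sum_nsmul] at hI
    -- weighted sum of the basis certificates
    have hII : ∑ a ∈ Fset, c a • (LevelRaise[2, 33, A a] + (N66 a).sum) =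
        ∑ a ∈ Fset, c a • (LevelRaise[2, 33, B a] + (if oddF a then LevelRaise[2, 33, G] else 0) + (P66 a).sum) :=
      Finset.sum_congr rfl fun a ha ↦ by rw [cert66_of_mem_F a ha]
    simp only [nsmul_add, Finset.sum_add_distrib] at hII
    have hodd : ∑ a ∈ Fset, c a • (if oddF a then LevelRaise[2, 33, G] else 0) = n • LevelRaise[2, 33, G] := by
      rw [hn, ← Finset.sum_nsmul_assoc]
      exact Finset.sum_congr rfl fun a _ ↦ by split_ifs <;> simp
    rw [hodd] at hII
    rw [Multiset.sum_add, Multiset.sum_add, sum_nsmul', sum_nsmul', sum_sum_nsmul, sum_sum_nsmul]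
    -- now a linear computation in the additive cancellative monoid of multisets
    have hIII := identity_sixtySix
    -- goal: 2•s + (ΣcN + n•ΣNEG) = ΣcP + n•ΣPOS
    have key : LevelRaise[2, 33, s] + (∑ a ∈ Fset, c a • (N66 a).sum) + n • NEG.sum +
        ∑ a ∈ Fset, c a • LevelRaise[2, 33, B a] =
        (∑ a ∈ Fset, c a • (P66 a).sum) + n • POS.sum + ∑ a ∈ Fset, c a • LevelRaise[2, 33, B a] := by
      calc LevelRaise[2, 33, s] + (∑ a ∈ Fset, c a • (N66 a).sum) + n • NEG.sum + ∑ a ∈ Fset, c a • LevelRaise[2, 33, B a]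
          = (LevelRaise[2, 33, s] + ∑ a ∈ Fset, c a • LevelRaise[2, 33, B a]) + (∑ a ∈ Fset, c a • (N66 a).sum) + n • NEG.sum := by
            abel
        _ = (∑ a ∈ Fset, c a • LevelRaise[2, 33, A a]) + (∑ a ∈ Fset, c a • (N66 a).sum) + n • NEG.sum := by rw [hI]
        _ = (∑ a ∈ Fset, c a • LevelRaise[2, 33, B a]) + n • LevelRaise[2, 33, G] + (∑ a ∈ Fset, c a • (P66 a).sum) + n • NEG.sum := by
            rw [hII]
        _ = (∑ a ∈ Fset, c a • LevelRaise[2, 33, B a]) + (∑ a ∈ Fset, c a • (P66 a).sum) + n • (LevelRaise[2, 33, G] + NEG.sum) := by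
            rw [nsmul_add]; abel
        _ = (∑ a ∈ Fset, c a • (P66 a).sum) + n • POS.sum + ∑ a ∈ Fset, c a • LevelRaise[2, 33, B a] := by
            rw [hIII]; abel
    have key' := add_right_cancel key
    rw [← key']
    abel


/-! ### §6 Pay-off: HC for every Fermat variety of degree 33, modulo the named facts and the remaining stubs -/

open CategoryTheory AlgebraicGeometry
open Literature.AlgebraicGeometry Literature.AlgebraicGeometry.Motives Literature.AlgebraicTopology.SingularHomology

/-- **Claim for every non-empty Hodge multiset of level `33`** from the LANDED lever (S1,
`stub_latticeCriterion`) and supply certificate (S3b, `stub_printedSupply`), the proved level-raising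
arithmetic (`isHodgeMultiset_levelRaise`) and `stableReach_thirtyThree`, granted the named facts
(Aoki 1987 Thm 1-4 (i),(ii), Thm 1-1, Thm 2-1; Aoki–Shioda 1983 (2.1)) and the statements of the
stubs S2↑ (`hPull`), S2↓ (`hPush`), S3a (`h3a`). [folklore assembly] -/
theorem claimMultiset_thirtyThree
    (hJ : Aoki1987_claim_juxtaposition) (hC : Aoki1987_claim_of_claim_juxtaposition_paired)
    (hP : Shioda_claim_paired) (hNS : AokiShioda1983_eigenline_le_neronSeveri) (hS : Aoki1987_claim_pStandard)
    (hPull : ∀ (m k r : ℕ) (α' : Fin (2 * r + 2) → ZMod m), 0 < k → (∀ i, α' i ≠ 0) →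
      FermatCharacter.Claim m r α' →
        FermatCharacter.Claim (k * m) r (fun i => ((k * (α' i).val : ℕ) : ZMod (k * m))))
    (hPush : ∀ (m k r : ℕ) (α' : Fin (2 * r + 2) → ZMod m), 0 < k → (∀ i, α' i ≠ 0) →
      FermatCharacter.Claim (k * m) r (fun i => ((k * (α' i).val : ℕ) : ZMod (k * m))) →
        FermatCharacter.Claim m r α')
    (h3a : ∀ (M : ℕ) [NeZero M] (s : Multiset (ZMod M)), IsHodgeMultiset s → IsSemiDecomposable s →
      ClaimMultiset M s)
    {s : Multiset (ZMod 33)} (hs0 : s ≠ 0) (hs : IsHodgeMultiset s) : ClaimMultiset 33 s := by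
  have h2 : ∀ (m k : ℕ) [NeZero m], 0 < k → ∀ s : Multiset (ZMod m), s ≠ 0 → IsHodgeMultiset s →
      IsHodgeMultiset (LevelRaise[k, m, s]) ∧ (ClaimMultiset m s ↔ ClaimMultiset (k * m) (LevelRaise[k, m, s])) :=
    fun m k _ hk s hs0 hs ↦ ⟨isHodgeMultiset_levelRaise m k hk s hs0 hs,
      claimMultiset_levelRaise_iff_of_pull_push hPull hPush m k hk s hs0 hs⟩
  obtain ⟨k, hk, P, N, hPs, hNs, hEq⟩ := stableReach_thirtyThree s hs
  haveI : NeZero (k * 33) := ⟨Nat.mul_ne_zero hk.ne' (by norm_num)⟩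
  obtain ⟨hsk, hiff⟩ := h2 33 k hk s hs0 hs
  have hsk0 : LevelRaise[k, 33, s] ≠ 0 := fun h ↦ hs0 (Multiset.map_eq_zero.1 h)
  exact hiff.2 (stub_latticeCriterion hJ hC (k * 33) (Supply[k * 33])
    (stub_printedSupply hP hNS hS h3a h2 (k * 33)) _ P N hsk0 hsk hPs hNs hEq)

/-- **HC FOR EVERY COMPLEX FERMAT VARIETY OF DEGREE `33`** — the first degree open in print
(da Silva 2021: `X⁴₃₃`) — granted the six named facts of the line's S0 (Aoki 1987 Thm 1-4 (i),(ii),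
Thm 1-1, Thm 2-1; Aoki–Shioda 1983 (2.1); Hodge models) and the statements of the remaining
research-risk-nil stubs S2↑ `hPull`, S2↓ `hPush` (pull-back / push-forward of claim along
`[xᵢ] ↦ [xᵢᵏ]`), S3a `h3a` (Shioda's semi-decomposable supply) and S5 `h5` (Ran 1980 Prop. 1.7 at
`m = 33`). No engine (S4) is used: degree `33` is SATURATED (`stableReach_thirtyThree`). The cycle part
is the tree's per-degree assembly `hodgeClasses_algebraic_fermat_of_claims_at'` (Lefschetz off the
middle degree discharged there). In particular, under the same hypotheses,
`DerivedTorelliFermat.FermatFourfoldThirtyThree` (stmt-HodgeConjecture-11125) holds.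
[cite: daSilva2021HodgeFermat, §3 Prop. 3.6 and Question 1 (X⁴₃₃)] [cite: Aoki1987, Thm 1-4, Thm 2-1] -/
theorem hodgeConjectureFor_thirtyThree
    (hJ : Aoki1987_claim_juxtaposition) (hC : Aoki1987_claim_of_claim_juxtaposition_paired)
    (hP : Shioda_claim_paired) (hNS : AokiShioda1983_eigenline_le_neronSeveri) (hS : Aoki1987_claim_pStandard)
    (hModel : ∀ (n : ℕ) (X : SchemeOver ℂ), nonempty_hodgeModel n X)
    (hPull : ∀ (m k r : ℕ) (α' : Fin (2 * r + 2) → ZMod m), 0 < k → (∀ i, α' i ≠ 0) →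
      FermatCharacter.Claim m r α' →
        FermatCharacter.Claim (k * m) r (fun i => ((k * (α' i).val : ℕ) : ZMod (k * m))))
    (hPush : ∀ (m k r : ℕ) (α' : Fin (2 * r + 2) → ZMod m), 0 < k → (∀ i, α' i ≠ 0) →
      FermatCharacter.Claim (k * m) r (fun i => ((k * (α' i).val : ℕ) : ZMod (k * m))) →
        FermatCharacter.Claim m r α')
    (h3a : ∀ (M : ℕ) [NeZero M] (s : Multiset (ZMod M)), IsHodgeMultiset s → IsSemiDecomposable s →
      ClaimMultiset M s)
    (h5 : ∀ ⦃p : ℕ⦄, 0 < p →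
      (∀ α : Fin (2 * p + 2) → ZMod 33, α ≠ 0 → (∃ i, α i = 0) → fermatEigenspace 33 α (2 * p) = ⊥) ∧
      (fermatEigenspace 33 (0 : Fin (2 * p + 2) → ZMod 33) (2 * p) ≤
        LinearMap.range (complexBetti.map (SmoothHypersurface.hypersurfaceι (fermatPolynomial ℂ (2 * p) 33)) (2 * p)).hom) ∧
      (∀ (A : HodgeModel (2 * p) (fermatHypersurface (2 * p) 33)) (β : Fin (2 * p + 2) → ZMod 33),
        (∀ i, β i ≠ 0) →
        (∃ x ∈ fermatEigenspace 33 β (2 * p), x ≠ 0 ∧ A.pullback (2 * p) x ∈ A.hodgePQ (2 * p) p p) →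
          2 * FermatCharacter.normSum β = 33 * (2 * p + 2)))
    ⦃n : ℕ⦄ ⦃X : SchemeOver ℂ⦄ (hF : IsFermatVariety n 33 X) (hX : IsSmoothProjective n X) :
    HodgeConjectureFor n X := by
  refine ⟨hModel n X hX, fun p c hc hpp ↦ ?_⟩
  refine hodgeClasses_algebraic_fermat_of_claims_at' (m := 33) h5 (fun p hp α hα ↦ ?_) hF hX p c hc hpp
  have hs : IsHodgeMultiset (univ.val.map α) := hα.isHodgeMultiset
  have hs0 : univ.val.map α ≠ 0 := by
    intro h0
    have hcard := congrArg Multiset.card h0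
    rw [card_univ_val_map, Multiset.card_zero] at hcard
    omega
  exact (claimMultiset_univ_val_map_iff α).1 (claimMultiset_thirtyThree hJ hC hP hNS hS hPull hPush h3a hs0 hs)

end Summit.HodgeConjecture.HodgeConjecture.Theorems.CancelByAnyClaimLattice.D33

end
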